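import Summits.AtomisticToContinuum.Crystallization.Theses.PerronTransitivity
import Summits.AtomisticToContinuum.Crystallization.Theorems.PalmUnimodularRigidityUnimodularEnergyLowerBoundCluster
import Literature.MathematicalPhysics.StatisticalMechanics.LennardJonesClusters
import HarnessLib

/-!
# The weighted cluster inequality from no fractional gain (`K*`)

Support file for item `stmt-AtomisticToContinuum-15776` (`MinimisingLawsHaveAtoms`, route
`IsometryAtoms`, line `perron_transfer`).  The deterministic energy input of the WEIGHTED
ball-centre mass transport: the landed unweighted cluster inequality
`UnimodularEnergy.setLIntegral_ball_cluster_le` with site weights `c y, c z ∈ [0, 1]` (as `ℝ≥0∞`)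
inserted, the periodisation bound `2·#T·e* ≤ Σ_{y,z} V_LJ` being replaced by the copositive
hypothesis `K* = NoFractionalGain`:
`2 e* Σ_i c_i² ≤ Σ_i Σ_{j ≠ i} c_i c_j V_LJ(dist x_i x_j)` for every finite injective configuration
and every non-negative real weights.

* `wci_two_mul_eStar_mul_sum_sq_le`: `K*` on a finset `T ⊂ ℝ³` with real weights, double-sum form
  (the diagonal terms vanish, `V_LJ(0) = 0`);
* `wci_sum_sum_real_le` / `wci_sum_sum_le`: the weighted cluster inequality without subtraction,
  in `ℝ` and in `ℝ≥0∞`;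
* `wci_setLIntegral_ball_le` / `stub_weightedClusterIneq`: the same dressed as integrals against
  the counting measure `count|S` of a separated set over the points of a ball, the infinite outside
  parts `∫_{B(v,R)ᶜ} c V⁻ dμ` appearing identically on both sides.

All `[folklore]` (given `K*`).
-/

noncomputable section

namespace Summit.AtomisticToContinuum.Crystallization.Theorems.IsometryAtomsMinimisingLawsHaveAtoms

open MeasureTheory Metric Set
open scoped ENNReal
open Literature.MathematicalPhysics.StatisticalMechanics
open Summit.AtomisticToContinuum.Crystallization.Theorems.ChargedEnergyGapNegative (E3 eStar)
open Summit.AtomisticToContinuum.Crystallization.Theorems.UnimodularEnergy (eStar_nonpos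
  ofReal_max_zero setLIntegral_ball_count_restrict finite_ball_inter)
open Summit.AtomisticToContinuum.Crystallization.Theses.PerronTransitivity (NoFractionalGain)

/-! ### The finite inequality -/

section Finite

/-- **`K*` on a finset, double-sum form.** For every finite `T ⊂ ℝ³` and non-negative real weights
`a`, `2 e* Σ_{y ∈ T} a_y² ≤ Σ_{y ∈ T} Σ_{z ∈ T} a_y a_z V_LJ(‖z - y‖)` (the diagonal terms vanish,
`V_LJ(0) = 0`). [folklore] -/
theorem wci_two_mul_eStar_mul_sum_sq_le (hK : NoFractionalGain) (T : Finset E3) (a : E3 → ℝ)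
    (ha : ∀ x, 0 ≤ a x) :
    2 * eStar * ∑ y ∈ T, a y ^ 2 ≤ ∑ y ∈ T, ∑ z ∈ T, a y * (a z * lennardJones ‖z - y‖) := by
  set e : {z // z ∈ T} ≃ Fin T.card := T.equivFin with he
  set x : Fin T.card → E3 := fun i => (e.symm i : E3) with hx
  have hxinj : Function.Injective x := fun i j h =>
    e.symm.injective (Subtype.ext h)
  have h1 := hK _ x hxinj (fun i => a (x i)) (fun i => ha _)
  have h2 : ∑ i, a (x i) ^ 2 = ∑ y ∈ T, a y ^ 2 := by
    rw [← Finset.sum_coe_sort T (fun y => a y ^ 2), ← Equiv.sum_comp e.symm]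
  have inner : ∀ i : Fin T.card,
      ∑ j ∈ Finset.univ.erase i, a (x i) * a (x j) * lennardJones (dist (x i) (x j)) =
        ∑ z ∈ T, a (x i) * (a z * lennardJones ‖z - x i‖) := by
    intro i
    have hdiag : a (x i) * a (x i) * lennardJones (dist (x i) (x i)) = 0 := by
      rw [dist_self, lennardJones_zero, mul_zero]
    rw [Finset.sum_erase (f := fun j => a (x i) * a (x j) * lennardJones (dist (x i) (x j)))
      Finset.univ hdiag, ← Finset.sum_coe_sort T
      (fun z => a (x i) * (a z * lennardJones ‖z - x i‖)), ← Equiv.sum_comp e.symm]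
    refine Finset.sum_congr rfl fun j _ => ?_
    rw [dist_comm, dist_eq_norm, mul_assoc]
  have h3 : ∑ i, ∑ j ∈ Finset.univ.erase i, a (x i) * a (x j) * lennardJones (dist (x i) (x j)) =
      ∑ y ∈ T, ∑ z ∈ T, a y * (a z * lennardJones ‖z - y‖) := by
    rw [Finset.sum_congr rfl fun i _ => inner i, ← Finset.sum_coe_sort T
      (fun y => ∑ z ∈ T, a y * (a z * lennardJones ‖z - y‖)), ← Equiv.sum_comp e.symm]
  rw [← h2, ← h3]
  exact h1

/-- **The weighted cluster inequality, real form.** For every finite `T ⊂ ℝ³` and non-negative real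
weights `a`:
`Σ_{y,z ∈ T} a_y a_z V_LJ(‖z-y‖)⁻ ≤ Σ_{y ∈ T} (Σ_{z ∈ T} a_y a_z V_LJ(‖z-y‖)⁺ + 2 (-e*)⁺ a_y²)`.
[folklore] -/
theorem wci_sum_sum_real_le (hK : NoFractionalGain) (T : Finset E3) (a : E3 → ℝ)
    (ha : ∀ x, 0 ≤ a x) :
    ∑ y ∈ T, ∑ z ∈ T, a y * (a z * max (-lennardJones ‖z - y‖) 0) ≤
      ∑ y ∈ T, (∑ z ∈ T, a y * (a z * max (lennardJones ‖z - y‖) 0) +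
        2 * max (-eStar) 0 * a y ^ 2) := by
  have key := wci_two_mul_eStar_mul_sum_sq_le hK T a ha
  have hsplit : ∀ t : ℝ, max (-t) 0 = max t 0 - t := fun t => by
    rcases le_total t 0 with h | h
    · rw [max_eq_left (neg_nonneg.2 h), max_eq_right h]; ring
    · rw [max_eq_right (neg_nonpos.2 h), max_eq_left h]; ring
  have hE : max (-eStar) 0 = -eStar := max_eq_left (neg_nonneg.2 eStar_nonpos)
  calc ∑ y ∈ T, ∑ z ∈ T, a y * (a z * max (-lennardJones ‖z - y‖) 0)
      = ∑ y ∈ T, ∑ z ∈ T, a y * (a z * max (lennardJones ‖z - y‖) 0) -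
          ∑ y ∈ T, ∑ z ∈ T, a y * (a z * lennardJones ‖z - y‖) := by
        rw [← Finset.sum_sub_distrib]
        refine Finset.sum_congr rfl fun y _ => ?_
        rw [← Finset.sum_sub_distrib]
        refine Finset.sum_congr rfl fun z _ => ?_
        rw [hsplit]
        ring
    _ ≤ ∑ y ∈ T, ∑ z ∈ T, a y * (a z * max (lennardJones ‖z - y‖) 0) -
          2 * eStar * ∑ y ∈ T, a y ^ 2 := by linarith
    _ = ∑ y ∈ T, (∑ z ∈ T, a y * (a z * max (lennardJones ‖z - y‖) 0) +
          2 * max (-eStar) 0 * a y ^ 2) := by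
        rw [Finset.sum_add_distrib, ← Finset.mul_sum, hE]
        ring

/-- Products of weights and a potential value under `ENNReal.ofReal`. [folklore] -/
theorem wci_ofReal_mul_ofReal_mul_ofReal {p q : ℝ} (t : ℝ) (hp : 0 ≤ p) (hq : 0 ≤ q) :
    ENNReal.ofReal p * (ENNReal.ofReal q * ENNReal.ofReal t) =
      ENNReal.ofReal (p * (q * max t 0)) := by
  rw [ENNReal.ofReal_mul hp, ENNReal.ofReal_mul hq, ofReal_max_zero]

/-- **The weighted cluster inequality, `ℝ≥0∞` form.** For every finite `T ⊂ ℝ³` and weights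
`c ≤ 1` in `ℝ≥0∞`:
`Σ_{y ∈ T} c_y Σ_{z ∈ T} c_z V_LJ(‖z-y‖)⁻ ≤
  Σ_{y ∈ T} (c_y Σ_{z ∈ T} c_z V_LJ(‖z-y‖)⁺ + 2 (-e*)⁺ c_y²)` (no subtraction in `ℝ≥0∞`).
[folklore] -/
theorem wci_sum_sum_le (hK : NoFractionalGain) (T : Finset E3) (c : E3 → ℝ≥0∞)
    (hc : ∀ x, c x ≤ 1) :
    ∑ y ∈ T, c y * ∑ z ∈ T, c z * ENNReal.ofReal (-lennardJones ‖z - y‖) ≤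
      ∑ y ∈ T, (c y * ∑ z ∈ T, c z * ENNReal.ofReal (lennardJones ‖z - y‖) +
        2 * ENNReal.ofReal (-eStar) * c y ^ 2) := by
  obtain ⟨a, ha, hca⟩ : ∃ a : E3 → ℝ, (∀ x, 0 ≤ a x) ∧ ∀ x, c x = ENNReal.ofReal (a x) :=
    ⟨fun x => (c x).toReal, fun x => ENNReal.toReal_nonneg,
      fun x => (ENNReal.ofReal_toReal ((hc x).trans_lt ENNReal.one_lt_top).ne).symm⟩
  simp only [hca]
  have hnn : ∀ (y z : E3) (t : ℝ), 0 ≤ a y * (a z * max t 0) := fun y z t =>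
    mul_nonneg (ha y) (mul_nonneg (ha z) (le_max_right _ _))
  have h2 : ∀ y : E3, 0 ≤ 2 * max (-eStar) 0 * a y ^ 2 := fun y => by positivity
  have hL : ∑ y ∈ T, ENNReal.ofReal (a y) *
      ∑ z ∈ T, ENNReal.ofReal (a z) * ENNReal.ofReal (-lennardJones ‖z - y‖) =
      ENNReal.ofReal (∑ y ∈ T, ∑ z ∈ T, a y * (a z * max (-lennardJones ‖z - y‖) 0)) := by
    rw [ENNReal.ofReal_sum_of_nonneg fun y _ => Finset.sum_nonneg fun z _ => hnn y z _]
    refine Finset.sum_congr rfl fun y _ => ?_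
    rw [Finset.mul_sum, ENNReal.ofReal_sum_of_nonneg fun z _ => hnn y z _]
    exact Finset.sum_congr rfl fun z _ => wci_ofReal_mul_ofReal_mul_ofReal _ (ha y) (ha z)
  have hR : ∑ y ∈ T, (ENNReal.ofReal (a y) *
      ∑ z ∈ T, ENNReal.ofReal (a z) * ENNReal.ofReal (lennardJones ‖z - y‖) +
        2 * ENNReal.ofReal (-eStar) * ENNReal.ofReal (a y) ^ 2) =
      ENNReal.ofReal (∑ y ∈ T, (∑ z ∈ T, a y * (a z * max (lennardJones ‖z - y‖) 0) +
        2 * max (-eStar) 0 * a y ^ 2)) := by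
    rw [ENNReal.ofReal_sum_of_nonneg fun y _ =>
      add_nonneg (Finset.sum_nonneg fun z _ => hnn y z _) (h2 y)]
    refine Finset.sum_congr rfl fun y _ => ?_
    rw [ENNReal.ofReal_add (Finset.sum_nonneg fun z _ => hnn y z _) (h2 y), Finset.mul_sum,
      ENNReal.ofReal_sum_of_nonneg fun z _ => hnn y z _]
    congr 1
    · exact Finset.sum_congr rfl fun z _ => wci_ofReal_mul_ofReal_mul_ofReal _ (ha y) (ha z)
    · rw [ENNReal.ofReal_mul (by positivity : (0 : ℝ) ≤ 2 * max (-eStar) 0),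
        ENNReal.ofReal_mul (zero_le_two : (0 : ℝ) ≤ 2), ENNReal.ofReal_ofNat, ofReal_max_zero,
        ENNReal.ofReal_pow (ha y)]
  rw [hL, hR]
  exact ENNReal.ofReal_le_ofReal (wci_sum_sum_real_le hK T a ha)

end Finite

/-! ### Dressing: integrals against the counting measure over the points of a ball -/

section Dressing

variable {δ : ℝ} {S : Set E3}

/-- **The weighted cluster inequality for a ball of a hard-core configuration.** For
`μ = count|S`, `S` separated, weights `c ≤ 1` and any ball `B = B(v,R)`:
`∫_B c(y) ∫ c(z) V⁻(‖z-y‖) dμ(z) dμ(y) ≤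
  ∫_B [c(y) ∫ c(z) V⁺(‖z-y‖) dμ(z) + 2(-e*)⁺ c(y)² + c(y) ∫_{Bᶜ} c(z) V⁻(‖z-y‖) dμ(z)] dμ(y)`:
splitting the inner integral on the left into `B` and `Bᶜ`, the `Bᶜ` parts match and the `B`
parts are the finite inequality `wci_sum_sum_le` for the cluster `S ∩ B`. [folklore] -/
theorem wci_setLIntegral_ball_le (hK : NoFractionalGain) (hδ : 0 < δ)
    (hsep : ∀ x ∈ S, ∀ y ∈ S, x ≠ y → δ ≤ dist x y) (c : E3 → ℝ≥0∞) (hc : ∀ x, c x ≤ 1)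
    (v : E3) (R : ℝ) :
    ∫⁻ y in ball v R, c y * (∫⁻ z, c z * ENNReal.ofReal (-lennardJones ‖z - y‖)
        ∂((Measure.count : Measure E3).restrict S)) ∂((Measure.count : Measure E3).restrict S) ≤
      ∫⁻ y in ball v R,
        (c y * (∫⁻ z, c z * ENNReal.ofReal (lennardJones ‖z - y‖)
            ∂((Measure.count : Measure E3).restrict S)) +
          2 * ENNReal.ofReal (-eStar) * c y ^ 2 +
          c y * (∫⁻ z in (ball v R)ᶜ, c z * ENNReal.ofReal (-lennardJones ‖z - y‖)
            ∂((Measure.count : Measure E3).restrict S)))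
        ∂((Measure.count : Measure E3).restrict S) := by
  set μ : Measure E3 := (Measure.count : Measure E3).restrict S with hμ
  set T : Finset E3 := (finite_ball_inter hδ hsep v R).toFinset with hT
  rw [setLIntegral_ball_count_restrict hδ hsep v R, setLIntegral_ball_count_restrict hδ hsep v R]
  -- split the inner integrals on the left at the ball
  have hsplitL : ∀ y : E3, ∫⁻ z, c z * ENNReal.ofReal (-lennardJones ‖z - y‖) ∂μ =
      ∑ z ∈ T, c z * ENNReal.ofReal (-lennardJones ‖z - y‖) +
        ∫⁻ z in (ball v R)ᶜ, c z * ENNReal.ofReal (-lennardJones ‖z - y‖) ∂μ := fun y => by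
    rw [← lintegral_add_compl _ measurableSet_ball, setLIntegral_ball_count_restrict hδ hsep v R]
  -- drop the outside positive parts on the right
  have hdropR : ∀ y : E3, ∑ z ∈ T, c z * ENNReal.ofReal (lennardJones ‖z - y‖) ≤
      ∫⁻ z, c z * ENNReal.ofReal (lennardJones ‖z - y‖) ∂μ := fun y => by
    rw [← lintegral_add_compl _ measurableSet_ball, setLIntegral_ball_count_restrict hδ hsep v R]
    exact le_self_add
  calc ∑ y ∈ T, c y * ∫⁻ z, c z * ENNReal.ofReal (-lennardJones ‖z - y‖) ∂μ
      = ∑ y ∈ T, c y * ∑ z ∈ T, c z * ENNReal.ofReal (-lennardJones ‖z - y‖) +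
          ∑ y ∈ T, c y * ∫⁻ z in (ball v R)ᶜ, c z * ENNReal.ofReal (-lennardJones ‖z - y‖) ∂μ := by
        rw [← Finset.sum_add_distrib]
        exact Finset.sum_congr rfl fun y _ => by rw [hsplitL y, mul_add]
    _ ≤ ∑ y ∈ T, (c y * ∑ z ∈ T, c z * ENNReal.ofReal (lennardJones ‖z - y‖) +
          2 * ENNReal.ofReal (-eStar) * c y ^ 2) +
          ∑ y ∈ T, c y * ∫⁻ z in (ball v R)ᶜ, c z * ENNReal.ofReal (-lennardJones ‖z - y‖) ∂μ :=
        add_le_add (wci_sum_sum_le hK T c hc) le_rfl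
    _ ≤ ∑ y ∈ T, (c y * ∫⁻ z, c z * ENNReal.ofReal (lennardJones ‖z - y‖) ∂μ +
          2 * ENNReal.ofReal (-eStar) * c y ^ 2 +
          c y * ∫⁻ z in (ball v R)ᶜ, c z * ENNReal.ofReal (-lennardJones ‖z - y‖) ∂μ) := by
        rw [← Finset.sum_add_distrib]
        exact Finset.sum_le_sum fun y _ =>
          add_le_add (add_le_add (mul_le_mul_right (hdropR y) _) le_rfl) le_rfl

end Dressing

/-- **Stub `stub_weightedClusterIneq` of line `perron_transfer`** (item
`stmt-AtomisticToContinuum-15776`): given `K* = NoFractionalGain`, for `μ = count|S`, `S`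
`δ`-separated, weights `c ≤ 1` and any ball `B = B(v,R)`,
`∫_B c(y) ∫ c(z) V⁻(‖z-y‖) dμ dμ ≤
  ∫_B [c(y) ∫ c(z) V⁺(‖z-y‖) dμ + 2(-e*)⁺ c(y)² + c(y) ∫_{Bᶜ} c(z) V⁻(‖z-y‖) dμ] dμ`,
`e* = ⨅_Q e_LJ(Q)`. [folklore] -/
theorem stub_weightedClusterIneq : Summit.AtomisticToContinuum.Crystallization.Theses.PerronTransitivity.NoFractionalGain → ∀ δ : ℝ, 0 < δ → ∀ S : Set (EuclideanSpace ℝ (Fin 3)), (∀ x ∈ S, ∀ y ∈ S, x ≠ y → δ ≤ dist x y) → ∀ c : EuclideanSpace ℝ (Fin 3) → ENNReal, (∀ x, c x ≤ 1) → ∀ (v : EuclideanSpace ℝ (Fin 3)) (R : ℝ), ∫⁻ y in Metric.ball v R, c y * (∫⁻ z, c z * ENNReal.ofReal (-Literature.MathematicalPhysics.StatisticalMechanics.lennardJones ‖z - y‖) ∂((MeasureTheory.Measure.count : MeasureTheory.Measure (EuclideanSpace ℝ (Fin 3))).restrict S)) ∂((MeasureTheory.Measure.count : MeasureTheory.Measure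 (EuclideanSpace ℝ (Fin 3))).restrict S) ≤ ∫⁻ y in Metric.ball v R, (c y * (∫⁻ z, c z * ENNReal.ofReal (Literature.MathematicalPhysics.StatisticalMechanics.lennardJones ‖z - y‖) ∂((MeasureTheory.Measure.count : MeasureTheory.Measure (EuclideanSpace ℝ (Fin 3))).restrict S)) + 2 * ENNReal.ofReal (-(⨅ Q : Literature.MathematicalPhysics.StatisticalMechanics.PeriodicConfiguration 3, Q.energyPerParticle Literature.MathematicalPhysics.StatisticalMechanics.lennardJones)) * (c y) ^ 2 + c y * (∫⁻ z in (Metric.ball v R)ᶜ, c z * ENNReal.ofReal (-Literature.MathematicalPhysics.StatisticalMechanics.lennardJones ‖z - y‖) ∂((MeasureTheory.Measure.count : MeasureTheory.Measure (EuclideanSpace ℝ (Fin 3))).restrict S))) ∂((MeasureTheory.Measure.count : MeasureTheory.Measure (EuclideanSpace ℝ (Fin 3))).restrict S) := by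
  intro hK δ hδ S hsep c hc v R
  exact wci_setLIntegral_ball_le hK hδ hsep c hc v R

end Summit.AtomisticToContinuum.Crystallization.Theorems.IsometryAtomsMinimisingLawsHaveAtoms

end
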